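import Mathlib
import Summits.ABC.ABC.Statement
import Literature.NumberTheory.DiophantineGeometry.AbcWave0BakerExplicitProofs

/-!
# Baker's `Ξ`: the top rung of the door ladder, read off Baker's own text
(solo-ABC-informed, session 12)

Baker [cite: Baker2004, §2 (p. 256)] and Baker–Wüstholz [cite: BakerWustholz2007, §3.7 (pp. 66–68)]
attach to a linear form `Λ = u₁ log v₁ + ⋯ + uₙ log vₙ` the quantity
`Ξ = min(1, |Λ|) · ∏_p min(1, p · |Λ|_p)` (for `Λ = log(a/b)`, `c = a − b`: `|Λ|_p = |c|_p` if
`p ∣ c`, else `1`) and state: (1) **Conjecture 3** — an absolute `κ` with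
`max(|a|,|b|,|c|) ≪ N (log N/ω)^{κω}`, `ω = ω(ab)` the number of primes *in the linear form* — "is
equivalent to an estimate for `Ξ`"; (2) "in a slightly weaker form" the expected estimate is
`log Ξ ≫ −(log v₁ + ⋯ + log vₙ) log u`, `u = max |uⱼ|`; (3) versus the classical
`log |Λ| ≫ −C(n) h(v₁)⋯h(vₙ) log u` this is (i) `|Λ| ↦ Ξ` (all places at once) and (ii) the
*product* of the heights replaced by their *sum*.

In the labelling of `IsABCTriple` (`a + b = c`; Baker's `(a,b,c)` is our `(c,a,b)`): `Λ = log(c/a)`,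
`e^Λ − 1 = b/a`, the primes with `|Λ|_p < 1` are those of `b`, the `vⱼ` are the primes of `ca`.
Recorded here, sorry-free, hypotheses inlined, no claim about the conjectures themselves:
* `rad(b)/c ≤ Ξ ≤ rad(b)/max(a,b)` (`soloInformed_le_bakerXi`, `soloInformed_bakerXi_le`): a lower
  bound for `Ξ` is, up to a factor `2`, an upper bound for `c`;
* `abc ⟺ ∀ ε ∃ K, Ξ ≥ 1/(K N^ε rad(ca))` (`soloInformed_abc_iff_xiLowerBound`); Conjecture 3 (typed
  with `∃ κ > 0`) `⟺ ∃ κ K, Ξ ≥ 1/(K rad(ca)(log N/ω(ca))^{κω(ca)})`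
  (`soloInformed_bakerConj3_iff_xiLowerBound`); Conjecture 3 `⟹ abc`
  (`soloInformed_abc_of_bakerConj3`);
* the weak form (2) is treated in `SoloInformedQuasiPolyABC.lean` (it gives quasi-polynomial abc).
Role in the seat's report (`run/shared/lean/ideation/ABC/solo-informed/paper/paper.md`, §2.0): the
printed top row of the door ladder, of which Philippon's conjecture
(`SoloInformedPhilipponDoor.lean`, level `W`) and the `p`-adic door `H(σ)`
(`SoloInformedDoorB.lean`, level `W⁻`) are shadows.
-/
noncomputable section

open Finset Real UniqueFactorizationMonoid
open scoped ArithmeticFunction.omega Nat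
open Literature.NumberTheory.DiophantineGeometry

namespace Summit.ABC.ABC.Theorems

variable {a b c : ℕ}

/-- Baker's `Ξ = min(1,|Λ|) ∏_p min(1, p |Λ|_p)` for the linear form `Λ = log(c/a)` of the triple
`a + b = c`: `|Λ|_p = |b|_p = p^{-v_p(b)}` for `p ∣ b`, and the factor is `1` at all other primes
(written out in full at every use; no constant is introduced).
[cite: Baker2004, §2 (p. 256)] [cite: BakerWustholz2007, §3.7 (p. 68)] -/
local notation "ΞB(" a ", " b ", " c ")" =>
  (min 1 (Real.log ((c : ℝ) / (a : ℝ))) *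
    ∏ p ∈ Nat.primeFactors b, min 1 ((p : ℝ) / (p : ℝ) ^ Nat.factorization b p))

/-! ### The sandwich `rad(b)/c ≤ Ξ ≤ rad(b)/max(a,b)` -/

/-- Positivity bookkeeping for an abc triple. [folklore] -/
theorem soloInformed_xi_triple_pos (h : IsABCTriple a b c) : 0 < a ∧ 0 < b ∧ 0 < c ∧ a + b = c := by
  obtain ⟨ha, hb, habc, _⟩ := h
  exact ⟨ha, hb, by omega, habc⟩

/-- `rad(abc) = rad(ca) · rad(b)` for an abc triple. [folklore] -/
theorem soloInformed_rad_eq_radical_mul (h : IsABCTriple a b c) :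
    rad a b c = radical (c * a) * radical b := by
  obtain ⟨ha, hb, habc, hcop⟩ := h
  have hcb : Nat.Coprime c b := by
    rw [← habc]; exact Nat.coprime_add_self_left.mpr hcop
  have hcab : Nat.Coprime (c * a) b := Nat.coprime_mul_iff_left.mpr ⟨hcb, hcop⟩
  rw [rad_def, show a * b * c = c * a * b by ring,
    radical_mul (Nat.coprime_iff_isRelPrime.mp hcab)]

/-- The non-archimedean part of `Ξ` is `rad(b)/b`: `∏_{p ∣ b} min(1, p · p^{-v_p(b)}) = rad(b)/b`.
[folklore] -/
theorem soloInformed_prod_min_eq_radical_div (hb : b ≠ 0) :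
    ∏ p ∈ b.primeFactors, min 1 ((p : ℝ) / (p : ℝ) ^ b.factorization p) =
      ((radical b : ℕ) : ℝ) / b := by
  have h1 : ∀ p ∈ b.primeFactors,
      min 1 ((p : ℝ) / (p : ℝ) ^ b.factorization p) = (p : ℝ) / (p : ℝ) ^ b.factorization p := by
    intro p hp
    have hpp : p.Prime := Nat.prime_of_mem_primeFactors hp
    have hk : 1 ≤ b.factorization p :=
      hpp.factorization_pos_of_dvd hb (Nat.dvd_of_mem_primeFactors hp)
    have hp0 : (0 : ℝ) < p := by exact_mod_cast hpp.pos
    refine min_eq_right ?_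
    rw [div_le_one (pow_pos hp0 _)]
    calc (p : ℝ) = (p : ℝ) ^ 1 := (pow_one _).symm
      _ ≤ (p : ℝ) ^ b.factorization p :=
          pow_le_pow_right₀ (by exact_mod_cast hpp.one_lt.le) hk
  rw [Finset.prod_congr rfl h1, Finset.prod_div_distrib, Nat.radical_eq_prod_primeFactors,
    Nat.cast_prod]
  congr 1
  exact_mod_cast (Nat.prod_primeFactors_pow_factorization hb).symm

/-- **Lower bound** `rad(b)/c ≤ Ξ`, from `1 − 1/x ≤ log x` at `x = c/a`.
[cite: Baker2004, §2 (p. 256)] -/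
theorem soloInformed_le_bakerXi (h : IsABCTriple a b c) :
    ((radical b : ℕ) : ℝ) / c ≤ ΞB(a, b, c) := by
  obtain ⟨ha, hb, hc, habc⟩ := soloInformed_xi_triple_pos h
  have ha0 : (0 : ℝ) < a := by exact_mod_cast ha
  have hb0 : (0 : ℝ) < b := by exact_mod_cast hb
  have hc0 : (0 : ℝ) < c := by exact_mod_cast hc
  have hcab : (c : ℝ) = a + b := by exact_mod_cast habc.symm
  have hR : (0 : ℝ) ≤ ((radical b : ℕ) : ℝ) / b := by positivity
  rw [soloInformed_prod_min_eq_radical_div hb.ne']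
  have hlog : (b : ℝ) / c ≤ Real.log ((c : ℝ) / a) := by
    have h1 := Real.one_sub_inv_le_log_of_pos (show (0 : ℝ) < c / a by positivity)
    have h2 : (b : ℝ) / c = 1 - ((c : ℝ) / a)⁻¹ := by
      rw [inv_div]; field_simp; linarith [hcab]
    rw [h2]; exact h1
  have hbc1 : (b : ℝ) / c ≤ 1 := by rw [div_le_one hc0]; linarith
  calc ((radical b : ℕ) : ℝ) / c = (b : ℝ) / c * (((radical b : ℕ) : ℝ) / b) := by
        rw [div_mul_div_comm, div_eq_div_iff hc0.ne' (by positivity)]; ring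
    _ = min 1 ((b : ℝ) / c) * (((radical b : ℕ) : ℝ) / b) := by rw [min_eq_right hbc1]
    _ ≤ min 1 (Real.log ((c : ℝ) / a)) * (((radical b : ℕ) : ℝ) / b) :=
        mul_le_mul_of_nonneg_right (min_le_min_left 1 hlog) hR

/-- **Upper bound** `Ξ ≤ rad(b)/max(a,b)`, from `log x ≤ x − 1` at `x = c/a` and `min(1,·) ≤ 1`.
[cite: Baker2004, §2 (p. 256)] -/
theorem soloInformed_bakerXi_le (h : IsABCTriple a b c) :
    ΞB(a, b, c) ≤ ((radical b : ℕ) : ℝ) / max (a : ℝ) (b : ℝ) := by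
  obtain ⟨ha, hb, hc, habc⟩ := soloInformed_xi_triple_pos h
  have ha0 : (0 : ℝ) < a := by exact_mod_cast ha
  have hb0 : (0 : ℝ) < b := by exact_mod_cast hb
  have hcab : (c : ℝ) = a + b := by exact_mod_cast habc.symm
  have hR : (0 : ℝ) ≤ ((radical b : ℕ) : ℝ) / b := by positivity
  rw [soloInformed_prod_min_eq_radical_div hb.ne']
  have hlog : Real.log ((c : ℝ) / a) ≤ (b : ℝ) / a := by
    have h1 := Real.log_le_sub_one_of_pos (show (0 : ℝ) < c / a by positivity)
    have h2 : (c : ℝ) / a - 1 = b / a := by rw [hcab, add_div, div_self ha0.ne']; ring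
    rw [← h2]; exact h1
  calc min 1 (Real.log ((c : ℝ) / a)) * (((radical b : ℕ) : ℝ) / b)
      ≤ min 1 ((b : ℝ) / a) * (((radical b : ℕ) : ℝ) / b) :=
        mul_le_mul_of_nonneg_right (min_le_min_left 1 hlog) hR
    _ ≤ ((radical b : ℕ) : ℝ) / max (a : ℝ) (b : ℝ) := by
        rcases le_total (a : ℝ) b with hab | hab
        · rw [max_eq_right hab]
          calc min 1 ((b : ℝ) / a) * (((radical b : ℕ) : ℝ) / b)
              ≤ 1 * (((radical b : ℕ) : ℝ) / b) :=
                mul_le_mul_of_nonneg_right (min_le_left _ _) hR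
            _ = ((radical b : ℕ) : ℝ) / b := one_mul _
        · rw [max_eq_left hab]
          calc min 1 ((b : ℝ) / a) * (((radical b : ℕ) : ℝ) / b)
              ≤ (b : ℝ) / a * (((radical b : ℕ) : ℝ) / b) :=
                mul_le_mul_of_nonneg_right (min_le_right _ _) hR
            _ = ((radical b : ℕ) : ℝ) / a := by
                rw [div_mul_div_comm, div_eq_div_iff (by positivity) ha0.ne']; ring

/-- `Ξ > 0` for an abc triple. [folklore] -/
theorem soloInformed_bakerXi_pos (h : IsABCTriple a b c) : 0 < ΞB(a, b, c) := by
  obtain ⟨-, -, hc, -⟩ := soloInformed_xi_triple_pos h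
  have h0 : (0 : ℝ) < ((radical b : ℕ) : ℝ) / c :=
    div_pos (by exact_mod_cast Nat.radical_pos b) (by exact_mod_cast hc)
  exact h0.trans_le (soloInformed_le_bakerXi h)

/-- `1 ≤ ω(ca)` for an abc triple (`ca ≥ 2`). [folklore] -/
theorem soloInformed_one_le_omega_ca (h : IsABCTriple a b c) : 1 ≤ ω (c * a) := by
  obtain ⟨ha, hb, hc, habc⟩ := soloInformed_xi_triple_pos h
  rw [cardDistinctFactors_eq_card_primeFactors]
  refine Finset.card_pos.mpr (Nat.nonempty_primeFactors.mpr ?_)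
  calc 1 < c := by omega
    _ ≤ c * a := Nat.le_mul_of_pos_right c ha

/-! ### `abc` and Conjecture 3 as estimates for `Ξ` -/

/-- **`abc` is an estimate for `Ξ`.** `abc ⟺ ∀ ε > 0 ∃ K > 0 ∀ (a,b,c), Ξ ≥ 1/(K · N^ε · rad(ca))`
with `N = rad(abc) = rad(ca) rad(b)`; only the factor `c / max(a,b) ≤ 2` is lost.
[cite: Baker2004, §2 (p. 256)] [cite: BakerWustholz2007, §3.7 (p. 68)] -/
theorem soloInformed_abc_iff_xiLowerBound :
    _root_.ABC ↔
      ∀ ε : ℝ, 0 < ε → ∃ K : ℝ, 0 < K ∧ ∀ a b c : ℕ, IsABCTriple a b c →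
        (K * ((rad a b c : ℕ) : ℝ) ^ ε * ((radical (c * a) : ℕ) : ℝ))⁻¹ ≤
          ΞB(a, b, c) := by
  constructor
  · intro hABC ε hε
    obtain ⟨C, hC, hC'⟩ := (_root_.ABC_iff.mp hABC) ε hε
    refine ⟨C, hC, fun a b c ht => ?_⟩
    obtain ⟨ha, hb, hc, habc⟩ := soloInformed_xi_triple_pos ht
    have hc0 : (0 : ℝ) < c := by exact_mod_cast hc
    have hN0 : (0 : ℝ) < ((rad a b c : ℕ) : ℝ) := by
      exact_mod_cast lt_of_lt_of_le (by norm_num) ht.two_le_rad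
    have hN : ((rad a b c : ℕ) : ℝ) = ((radical (c * a) : ℕ) : ℝ) * ((radical b : ℕ) : ℝ) := by
      rw [soloInformed_rad_eq_radical_mul ht]; push_cast; ring
    have hpow : ((rad a b c : ℕ) : ℝ) ^ (1 + ε) =
        ((rad a b c : ℕ) : ℝ) ^ ε * (((radical (c * a) : ℕ) : ℝ) * ((radical b : ℕ) : ℝ)) := by
      rw [← hN, add_comm, Real.rpow_add_one hN0.ne']
    refine le_trans ?_ (soloInformed_le_bakerXi ht)
    rw [inv_eq_one_div, div_le_div_iff₀ (by positivity) hc0, one_mul]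
    calc (c : ℝ) ≤ C * ((rad a b c : ℕ) : ℝ) ^ (1 + ε) := (hC' a b c ht).le
      _ = ((radical b : ℕ) : ℝ) *
          (C * ((rad a b c : ℕ) : ℝ) ^ ε * ((radical (c * a) : ℕ) : ℝ)) := by rw [hpow]; ring
  · intro hXi
    rw [_root_.ABC_iff]
    intro ε hε
    obtain ⟨K, hK, hK'⟩ := hXi ε hε
    refine ⟨2 * K + 1, by positivity, fun a b c ht => ?_⟩
    obtain ⟨ha, hb, hc, habc⟩ := soloInformed_xi_triple_pos ht
    have ha0 : (0 : ℝ) < a := by exact_mod_cast ha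
    have hcab : (c : ℝ) = a + b := by exact_mod_cast habc.symm
    have hN0 : (0 : ℝ) < ((rad a b c : ℕ) : ℝ) := by
      exact_mod_cast lt_of_lt_of_le (by norm_num) ht.two_le_rad
    have hN : ((rad a b c : ℕ) : ℝ) = ((radical (c * a) : ℕ) : ℝ) * ((radical b : ℕ) : ℝ) := by
      rw [soloInformed_rad_eq_radical_mul ht]; push_cast; ring
    have hpow : ((rad a b c : ℕ) : ℝ) ^ (1 + ε) =
        ((rad a b c : ℕ) : ℝ) ^ ε * (((radical (c * a) : ℕ) : ℝ) * ((radical b : ℕ) : ℝ)) := by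
      rw [← hN, add_comm, Real.rpow_add_one hN0.ne']
    have hM0 : (0 : ℝ) < max (a : ℝ) b := lt_max_of_lt_left ha0
    have h1 := le_trans (hK' a b c ht) (soloInformed_bakerXi_le ht)
    rw [inv_eq_one_div, div_le_div_iff₀ (by positivity) hM0, one_mul] at h1
    have hcle : (c : ℝ) ≤ 2 * max (a : ℝ) b := by
      rw [hcab]; linarith [le_max_left (a : ℝ) b, le_max_right (a : ℝ) b]
    have hNε : 0 < ((rad a b c : ℕ) : ℝ) ^ (1 + ε) := Real.rpow_pos_of_pos hN0 _
    calc (c : ℝ) ≤ 2 * max (a : ℝ) b := hcle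
      _ ≤ 2 * (((radical b : ℕ) : ℝ) *
          (K * ((rad a b c : ℕ) : ℝ) ^ ε * ((radical (c * a) : ℕ) : ℝ))) := by linarith
      _ = 2 * K * ((rad a b c : ℕ) : ℝ) ^ (1 + ε) := by rw [hpow]; ring
      _ < (2 * K + 1) * ((rad a b c : ℕ) : ℝ) ^ (1 + ε) := by nlinarith

/-- **Baker's Conjecture 3 is an estimate for `Ξ`** (Baker: "Conjecture 3 is equivalent to an
estimate for `Ξ`"): with `ω = ω(ca)` the number of primes in the linear form and `N = rad(abc)`,
`(∃ κ K, c ≤ K N (log N/ω)^{κω}) ⟺ (∃ κ K, Ξ ≥ 1/(K rad(ca) (log N/ω)^{κω}))`.  Conjecture 3 is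
typed with `∃ κ > 0` (Baker: "for some absolute constant κ").
[cite: Baker2004, §2 Conjecture 3 (p. 256)] [cite: BakerWustholz2007, §3.7 (pp. 66–68)] -/
theorem soloInformed_bakerConj3_iff_xiLowerBound :
    (∃ κ : ℝ, 0 < κ ∧ ∃ K : ℝ, 0 < K ∧ ∀ a b c : ℕ, IsABCTriple a b c →
        (c : ℝ) ≤ K * ((rad a b c : ℕ) : ℝ) *
          (Real.log ((rad a b c : ℕ) : ℝ) / ω (c * a)) ^ (κ * ω (c * a))) ↔
      ∃ κ : ℝ, 0 < κ ∧ ∃ K : ℝ, 0 < K ∧ ∀ a b c : ℕ, IsABCTriple a b c →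
        (K * ((radical (c * a) : ℕ) : ℝ) *
            (Real.log ((rad a b c : ℕ) : ℝ) / ω (c * a)) ^ (κ * ω (c * a)))⁻¹ ≤
          ΞB(a, b, c) := by
  -- shared facts
  have key : ∀ {a b c : ℕ}, IsABCTriple a b c → ∀ κ : ℝ,
      ((rad a b c : ℕ) : ℝ) = ((radical (c * a) : ℕ) : ℝ) * ((radical b : ℕ) : ℝ) ∧
      0 < (Real.log ((rad a b c : ℕ) : ℝ) / ω (c * a)) ^ (κ * ω (c * a)) := by
    intro a b c ht κ
    refine ⟨by rw [soloInformed_rad_eq_radical_mul ht]; push_cast; ring, ?_⟩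
    apply Real.rpow_pos_of_pos
    have hN2 : (2 : ℝ) ≤ ((rad a b c : ℕ) : ℝ) := by exact_mod_cast ht.two_le_rad
    have hw : (0 : ℝ) < ω (c * a) := by exact_mod_cast soloInformed_one_le_omega_ca ht
    exact div_pos (Real.log_pos (by linarith)) hw
  constructor
  · rintro ⟨κ, hκ, K, hK, H⟩
    refine ⟨κ, hκ, K, hK, fun a b c ht => ?_⟩
    obtain ⟨hN, hX⟩ := key ht κ
    obtain ⟨ha, hb, hc, habc⟩ := soloInformed_xi_triple_pos ht
    have hc0 : (0 : ℝ) < c := by exact_mod_cast hc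
    have hRca : (0 : ℝ) < ((radical (c * a) : ℕ) : ℝ) := by exact_mod_cast Nat.radical_pos _
    refine le_trans ?_ (soloInformed_le_bakerXi ht)
    rw [inv_eq_one_div, div_le_div_iff₀ (by positivity) hc0, one_mul]
    calc (c : ℝ) ≤ K * ((rad a b c : ℕ) : ℝ) *
          (Real.log ((rad a b c : ℕ) : ℝ) / ω (c * a)) ^ (κ * ω (c * a)) := H a b c ht
      _ = ((radical b : ℕ) : ℝ) * (K * ((radical (c * a) : ℕ) : ℝ) *
          (Real.log ((rad a b c : ℕ) : ℝ) / ω (c * a)) ^ (κ * ω (c * a))) := by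
          rw [hN]; ring
  · rintro ⟨κ, hκ, K, hK, H⟩
    refine ⟨κ, hκ, 2 * K, by positivity, fun a b c ht => ?_⟩
    obtain ⟨hN, hX⟩ := key ht κ
    obtain ⟨ha, hb, hc, habc⟩ := soloInformed_xi_triple_pos ht
    have ha0 : (0 : ℝ) < a := by exact_mod_cast ha
    have hcab : (c : ℝ) = a + b := by exact_mod_cast habc.symm
    have hRca : (0 : ℝ) < ((radical (c * a) : ℕ) : ℝ) := by exact_mod_cast Nat.radical_pos _
    have hM0 : (0 : ℝ) < max (a : ℝ) b := lt_max_of_lt_left ha0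
    have h1 := le_trans (H a b c ht) (soloInformed_bakerXi_le ht)
    rw [inv_eq_one_div, div_le_div_iff₀ (by positivity) hM0, one_mul] at h1
    have hcle : (c : ℝ) ≤ 2 * max (a : ℝ) b := by
      rw [hcab]; linarith [le_max_left (a : ℝ) b, le_max_right (a : ℝ) b]
    calc (c : ℝ) ≤ 2 * max (a : ℝ) b := hcle
      _ ≤ 2 * (((radical b : ℕ) : ℝ) * (K * ((radical (c * a) : ℕ) : ℝ) *
          (Real.log ((rad a b c : ℕ) : ℝ) / ω (c * a)) ^ (κ * ω (c * a)))) := by linarith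
      _ = 2 * K * ((rad a b c : ℕ) : ℝ) *
          (Real.log ((rad a b c : ℕ) : ℝ) / ω (c * a)) ^ (κ * ω (c * a)) := by rw [hN]; ring

/-- **Conjecture 3 implies `abc`**: `(log N/ω)^{κω} = ((log N)^ω/ω^ω)^κ ≤ ((log N)^ω/ω!)^κ ≤
(C_{ε/κ} N^{ε/κ})^κ`, using `ω(ca)! ≤ ω(abc)! ≤ N` and the tree's
`exists_const_log_pow_div_factorial_le`. [cite: Baker2004, §2–§3 (pp. 256–258)] -/
theorem soloInformed_abc_of_bakerConj3
    (h : ∃ κ : ℝ, 0 < κ ∧ ∃ K : ℝ, 0 < K ∧ ∀ a b c : ℕ, IsABCTriple a b c →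
        (c : ℝ) ≤ K * ((rad a b c : ℕ) : ℝ) *
          (Real.log ((rad a b c : ℕ) : ℝ) / ω (c * a)) ^ (κ * ω (c * a))) :
    _root_.ABC := by
  obtain ⟨κ, hκ, K, hK, H⟩ := h
  rw [_root_.ABC_iff]
  intro ε hε
  obtain ⟨C, hC1, hC⟩ := exists_const_log_pow_div_factorial_le (ε / κ) (by positivity)
  refine ⟨K * C ^ κ + 1, by positivity, fun a b c ht => ?_⟩
  obtain ⟨ha, hb, hc, habc⟩ := soloInformed_xi_triple_pos ht
  have hmain := H a b c ht
  have hfac0 : (ω (c * a))! ≤ rad a b c := by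
    have h1 : (ω (c * a))! ≤ (ω (a * b * c))! := by
      apply Nat.factorial_le
      rw [cardDistinctFactors_eq_card_primeFactors, cardDistinctFactors_eq_card_primeFactors]
      exact Finset.card_le_card (Nat.primeFactors_mono ⟨b, by ring⟩
        (Nat.mul_pos (Nat.mul_pos ha hb) hc).ne')
    have h2 := factorial_cardDistinctFactors_le_radical (a * b * c)
    rw [← rad_def] at h2
    exact h1.trans h2
  have hN2 : (2 : ℝ) ≤ ((rad a b c : ℕ) : ℝ) := by exact_mod_cast ht.two_le_rad
  have hfac : (((ω (c * a))! : ℕ) : ℝ) ≤ ((rad a b c : ℕ) : ℝ) := by exact_mod_cast hfac0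
  have hw0 : (0 : ℝ) < ω (c * a) := by exact_mod_cast soloInformed_one_le_omega_ca ht
  set N : ℝ := ((rad a b c : ℕ) : ℝ) with hN_def
  set w : ℕ := ω (c * a) with hw_def
  have hN1 : (1 : ℝ) ≤ N := by linarith
  have hN0 : 0 < N := by linarith
  have hlogN : 0 < Real.log N := Real.log_pos (by linarith)
  have hbase : 0 ≤ Real.log N / w := by positivity
  have hX : (Real.log N / w) ^ (κ * w) ≤ C ^ κ * N ^ ε := by
    rw [mul_comm κ, Real.rpow_mul hbase, Real.rpow_natCast]
    have h3 : (Real.log N / w) ^ w ≤ C * N ^ (ε / κ) := by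
      have hwf : (0 : ℝ) < (w ! : ℕ) := by exact_mod_cast Nat.factorial_pos w
      calc (Real.log N / w) ^ w = Real.log N ^ w / (w : ℝ) ^ w := div_pow _ _ _
        _ ≤ Real.log N ^ w / (w ! : ℕ) := by
            apply div_le_div_of_nonneg_left (by positivity) hwf
            exact_mod_cast Nat.factorial_le_pow w
        _ ≤ C * N ^ (ε / κ) := hC w N hN1 hfac
    calc ((Real.log N / w) ^ w) ^ κ ≤ (C * N ^ (ε / κ)) ^ κ :=
          Real.rpow_le_rpow (by positivity) h3 hκ.le
      _ = C ^ κ * N ^ ε := by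
          rw [Real.mul_rpow (by linarith) (by positivity), ← Real.rpow_mul hN0.le,
            div_mul_cancel₀ ε hκ.ne']
  have hNε : 0 < N ^ (1 + ε) := Real.rpow_pos_of_pos hN0 _
  have hsplit : N ^ (1 + ε) = N * N ^ ε := by rw [Real.rpow_add hN0, Real.rpow_one]
  have hKN : 0 ≤ K * N := by positivity
  calc (c : ℝ) ≤ K * N * (Real.log N / w) ^ (κ * w) := hmain
    _ ≤ K * N * (C ^ κ * N ^ ε) := mul_le_mul_of_nonneg_left hX hKN
    _ = K * C ^ κ * N ^ (1 + ε) := by rw [hsplit]; ring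
    _ < (K * C ^ κ + 1) * N ^ (1 + ε) := by nlinarith

end Summit.ABC.ABC.Theorems

end
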